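import Summits.CriticalPhenomena.PercolationContinuityZ3.Theorems.Transplant.HexShadowGluing
import Literature.Probability.Percolation.SlabGluingFact1
import HarnessLib

/-!
# HEXAGONAL SHADOWS XVII — towards the Gluing Lemma (DST §2.3) on a general graph: open self-avoiding paths, the vertex-lexicographic order
# through a fixed enumeration of the (countable) vertex type, and the minimal path `γ_min`

builds on p205010 (kernel theorem, internal audit signed; external expert review pending) — NOT used in this file.
Lane `prim-bschramm`, seat `prim-bschramm-p2` (gen 32; class C1b; memo `HOME/bschramm/P2-LATTICES.md` §116–§117); helper file
(`--supports stmt-CriticalPhenomena-4575 --as helper`).  Slab original: `Literature/…/SlabGluing` §"Paths" (`IsOSAP`, `vKey`, `pathKey`, `minPath`, …) and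
`SlabGluingFact1` §"PathConn"/"Fact1Proof" (`IsOSAP.openConnIn_of_mem`, `isOSAP_congr`, `minPath_congr`) — there for the vertex type `slab 3 k` with the
coordinate key; here VERBATIM for an arbitrary vertex type `V`, the key being a fixed injection `V ↪ ℕ` (from `Countable V`; DST: "fix an arbitrary order
`≪` on vertices").  Nothing hexagonal is used: this is the generic part of §2.3.
* §1 `OpenSAP ω S X Y l` — `l` is an `ω`-open self-avoiding path inside `S` from `X` to `Y` (a non-empty duplicate-free list of vertices of `S`, consecutive
  ones joined by open edges); monotonicity, restriction, the link with `openCrossing` (`mem_openCrossing_iff_exists_openSAP`), connectivity along the path;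
* §2 the key `vtxKey : V → ℕ` (injective), `sapKey l = l.map vtxKey` (lexicographic, a proper prefix is smaller), **`minSAP ω S X Y`** = the open
  self-avoiding path of least key (empty if none / `S` infinite): `minSAP_spec`, `minSAP_eq_nil`, `minSAP_eq_of_min`, the stability
  `minSAP_eq_of_subset` ("`γ_min(ω') = γ_min(ω)`" when edges off `γ_min` are closed) and the window property `minSAP_congr`.
[cite: DuminilCopinSidoraviciusTassion2016, §2.3 (the order on paths, Definition of γ_min, proof of Fact 1)] [cite: NewmanTassionWu2017, §3.2]
-/

noncomputable section

namespace Summit.CriticalPhenomena.PercolationContinuityZ3.Theorems.Transplant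

open MeasureTheory Literature.Probability.Percolation Literature.Probability.LatticeModels SimpleGraph Filter
open scoped Classical Topology

/-! ## §1 Open self-avoiding paths -/

/-- **Open self-avoiding paths** on a general vertex type: `l` is an `ω`-open self-avoiding path inside `S` from `X` to `Y` — a non-empty list of distinct
vertices of `S`, consecutive ones joined by open edges (`s(a,b) ∈ ω`, `a ≠ b`), starting in `X`, ending in `Y`.
[cite: DuminilCopinSidoraviciusTassion2016, §2.3 (self-avoiding paths from S̄_{3n} to Z̄_n)] -/
structure OpenSAP {V : Type} (ω : BondConfig V) (S X Y : Set V) (l : List V) : Prop where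
  /-- self-avoiding -/
  nodup : l.Nodup
  /-- consecutive vertices are joined by open edges -/
  chain : l.IsChain (fun a b => s(a, b) ∈ ω ∧ a ≠ b)
  /-- inside `S` -/
  subset : ∀ x ∈ l, x ∈ S
  /-- non-empty -/
  ne_nil : l ≠ []
  /-- starts in `X` -/
  head_mem : ∀ h : l ≠ [], l.head h ∈ X
  /-- ends in `Y` -/
  last_mem : ∀ h : l ≠ [], l.getLast h ∈ Y

namespace OpenSAP

variable {V : Type} {ω ω' : BondConfig V} {S X Y : Set V} {l : List V}

/-- Open self-avoiding paths persist in larger configurations. [folklore] -/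
theorem mono (h : ω ⊆ ω') (hl : OpenSAP ω S X Y l) : OpenSAP ω' S X Y l :=
  ⟨hl.nodup, hl.chain.imp fun _ _ hab => ⟨h hab.1, hab.2⟩, hl.subset, hl.ne_nil, hl.head_mem, hl.last_mem⟩

/-- An open self-avoiding path whose edges all lie in `ω'` is `ω'`-open. [folklore] -/
theorem of_edges (hl : OpenSAP ω S X Y l) (h : ∀ a ∈ l, ∀ b ∈ l, s(a, b) ∈ ω → s(a, b) ∈ ω') : OpenSAP ω' S X Y l :=
  ⟨hl.nodup, hl.chain.imp_of_mem_imp fun a b ha hb hab => ⟨h a ha b hb hab.1, hab.2⟩, hl.subset, hl.ne_nil, hl.head_mem, hl.last_mem⟩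

/-- Enlarging the target keeps an open self-avoiding path. [folklore] -/
theorem mono_target {Y' : Set V} (hY : Y ⊆ Y') (hl : OpenSAP ω S X Y l) : OpenSAP ω S X Y' l :=
  ⟨hl.nodup, hl.chain, hl.subset, hl.ne_nil, hl.head_mem, fun h => hY (hl.last_mem h)⟩

end OpenSAP

section Paths

variable {V : Type}

/-- Along a chain of open edges inside `S`, the first vertex is joined inside `S` to every vertex of the chain. [folklore] -/
theorem openConnIn_head_of_mem_chain {ω : BondConfig V} {S : Set V} :
    ∀ (a : V) (l : List V), (a :: l).IsChain (fun a b => s(a, b) ∈ ω ∧ a ≠ b) → (∀ x ∈ a :: l, x ∈ S) → ∀ v ∈ a :: l, ω ∈ openConnIn S a v := by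
  intro a l
  induction l generalizing a with
  | nil =>
    intro _ hS v hv
    rw [List.mem_singleton] at hv
    subst hv
    rw [mem_openConnIn_iff_pathIn]
    exact PathIn.refl (hS v (by simp))
  | cons b l ih =>
    intro hc hS v hv
    rw [List.isChain_cons_cons] at hc
    rcases List.mem_cons.1 hv with rfl | hv
    · rw [mem_openConnIn_iff_pathIn]
      exact PathIn.refl (hS v (by simp))
    · have h1 : ω ∈ openConnIn S a b := by
        rw [mem_openConnIn_iff_pathIn]
        exact PathIn.of_adj (hS a (by simp)) (hS b (by simp)) ((openGraph_adj ω a b).2 hc.1)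
      exact SlabCriticality.openConnIn_trans h1 (ih b hc.2 (fun x hx => hS x (by simp [hx])) v hv)

/-- The first vertex of an open self-avoiding path is joined inside `S` to every vertex of the path. [folklore] -/
theorem OpenSAP.openConnIn_of_mem {ω : BondConfig V} {S X Y : Set V} {l : List V} (hl : OpenSAP ω S X Y l) {v : V} (hv : v ∈ l) :
    ω ∈ openConnIn S (l.head hl.ne_nil) v := by
  obtain ⟨a, l', rfl⟩ := List.exists_cons_of_ne_nil hl.ne_nil
  exact openConnIn_head_of_mem_chain a l' hl.chain hl.subset v hv

/-- **`openCrossing S X Y` holds iff there is an open self-avoiding path inside `S` from `X` to `Y`.** [folklore] -/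
theorem mem_openCrossing_iff_exists_openSAP (ω : BondConfig V) (S X Y : Set V) : ω ∈ openCrossing S X Y ↔ ∃ l, OpenSAP ω S X Y l := by
  classical
  constructor
  · rintro ⟨x, hx, y, hy, hxB, hyB, hr⟩
    obtain ⟨W⟩ := hr
    set φ : (openGraph ω).induce S →g openGraph ω := (SimpleGraph.Embedding.induce S).toHom with hφ
    have hφinj : Function.Injective φ := fun a b h => Subtype.ext h
    set W' : (openGraph ω).Walk x y := W.toPath.1.map φ with hW'
    have hsupp : W'.support = W.toPath.1.support.map φ := Walk.support_map _ _
    have hnd : W'.support.Nodup := by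
      rw [hsupp]
      exact W.toPath.2.support_nodup.map hφinj
    have hS : ∀ v ∈ W'.support, v ∈ S := by
      intro v hv
      rw [hsupp, List.mem_map] at hv
      obtain ⟨w, -, rfl⟩ := hv
      exact w.2
    refine ⟨W'.support, hnd, ?_, hS, Walk.support_ne_nil W', fun h => ?_, fun h => ?_⟩
    · exact W'.isChain_adj_support.imp fun a b hab => (openGraph_adj ω a b).1 hab
    · rw [Walk.head_support]; exact hx
    · rw [Walk.getLast_support]; exact hy
  · rintro ⟨l, hl⟩
    obtain ⟨a, l', hal⟩ := List.exists_cons_of_ne_nil hl.ne_nil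
    refine ⟨l.head hl.ne_nil, hl.head_mem hl.ne_nil, l.getLast hl.ne_nil, hl.last_mem _, ?_⟩
    exact hl.openConnIn_of_mem (List.getLast_mem hl.ne_nil)

/-! ## §2 The order on paths and the minimal path -/

/-- **A fixed enumeration of the vertices** (DST's "arbitrary order `≪` on vertices", here through an injection into `ℕ` of the countable vertex type).
[cite: DuminilCopinSidoraviciusTassion2016, §2.3 (the order on self-avoiding paths)] -/
def vtxKey (V : Type) [Countable V] : V → ℕ := (Countable.exists_injective_nat V).choose

/-- The enumeration is injective. [folklore] -/
theorem vtxKey_injective (V : Type) [Countable V] : Function.Injective (vtxKey V) := (Countable.exists_injective_nat V).choose_spec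

/-- **The key of a path**: the list of keys of its vertices, compared lexicographically (a proper prefix is smaller) — the order on self-avoiding paths
of DST §2.3 in the vertex form of Newman–Tassion–Wu §3.2. [cite: DuminilCopinSidoraviciusTassion2016, §2.3] [cite: NewmanTassionWu2017, §3.2] -/
def sapKey {V : Type} [Countable V] (l : List V) : List ℕ := l.map (vtxKey V)

/-- `sapKey` is injective. [folklore] -/
theorem sapKey_injective (V : Type) [Countable V] : Function.Injective (sapKey (V := V)) :=
  List.map_injective_iff.2 (vtxKey_injective V)

/-- **The minimal open self-avoiding path `γ_min(ω)`** from `X` to `Y` inside `S`: the `ω`-open self-avoiding path of least key (the empty list if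
there is none or `S` is infinite). [cite: DuminilCopinSidoraviciusTassion2016, §2.3 (Definition of γ_min)] -/
def minSAP {V : Type} [Countable V] (ω : BondConfig V) (S X Y : Set V) : List V :=
  if h : S.Finite ∧ ∃ l, OpenSAP ω S X Y l then
    Classical.choose (Set.exists_min_image {l | OpenSAP ω S X Y l} sapKey
      ((finite_setOf_nodup_subset h.1).subset fun _ hl => ⟨hl.nodup, hl.subset⟩) h.2)
  else []

variable [Countable V]

/-- When an open self-avoiding path exists (inside a finite `S`), `minSAP` is one of them and its key is minimal. [folklore] -/
theorem minSAP_spec {ω : BondConfig V} {S X Y : Set V} (hS : S.Finite) (h : ∃ l, OpenSAP ω S X Y l) :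
    OpenSAP ω S X Y (minSAP ω S X Y) ∧ ∀ l, OpenSAP ω S X Y l → sapKey (minSAP ω S X Y) ≤ sapKey l := by
  have hh : S.Finite ∧ ∃ l, OpenSAP ω S X Y l := ⟨hS, h⟩
  rw [minSAP, dif_pos hh]
  exact Classical.choose_spec (Set.exists_min_image {l | OpenSAP ω S X Y l} sapKey
    ((finite_setOf_nodup_subset hh.1).subset fun _ hl => ⟨hl.nodup, hl.subset⟩) hh.2)

/-- Without open self-avoiding paths, `minSAP` is empty. [folklore] -/
theorem minSAP_eq_nil {ω : BondConfig V} {S X Y : Set V} (h : ¬∃ l, OpenSAP ω S X Y l) : minSAP ω S X Y = [] := by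
  rw [minSAP, dif_neg (fun hh => h hh.2)]

/-- Characterisation of the minimal path: the open self-avoiding path with minimal key. [folklore] -/
theorem minSAP_eq_of_min {ω : BondConfig V} {S X Y : Set V} (hS : S.Finite) {l : List V} (hl : OpenSAP ω S X Y l)
    (hmin : ∀ l', OpenSAP ω S X Y l' → sapKey l ≤ sapKey l') : minSAP ω S X Y = l := by
  obtain ⟨h1, h2⟩ := minSAP_spec hS ⟨l, hl⟩
  exact sapKey_injective V (le_antisymm (h2 l hl) (hmin _ h1))

/-- **Stability of the minimal path under closing edges off it**: if `ω' ⊆ ω` and the minimal path of `ω` is still `ω'`-open, it is the minimal path of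
`ω'` ("`γ_min(ω') = γ_min(ω)` since no edge of `γ_min` was closed"). [cite: DuminilCopinSidoraviciusTassion2016, §2.3 (proof of Fact 1)] -/
theorem minSAP_eq_of_subset {ω ω' : BondConfig V} (hω : ω' ⊆ ω) {S X Y : Set V} (hS : S.Finite) (h : ∃ l, OpenSAP ω S X Y l)
    (h' : OpenSAP ω' S X Y (minSAP ω S X Y)) : minSAP ω' S X Y = minSAP ω S X Y :=
  minSAP_eq_of_min hS h' fun l' hl' => (minSAP_spec hS h).2 l' (hl'.mono hω)

omit [Countable V] in
/-- Configurations agreeing on the pairs inside `S` have the same open self-avoiding paths inside `S`. [folklore] -/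
theorem openSAP_congr {ω ω' : BondConfig V} {S X Y : Set V} (h : ∀ e ∈ S.sym2, e ∈ ω ↔ e ∈ ω') (l : List V) :
    OpenSAP ω S X Y l ↔ OpenSAP ω' S X Y l :=
  ⟨fun hl => hl.of_edges fun a ha b hb hab => (h _ (Set.mk_mem_sym2_iff.2 ⟨hl.subset a ha, hl.subset b hb⟩)).1 hab,
   fun hl => hl.of_edges fun a ha b hb hab => (h _ (Set.mk_mem_sym2_iff.2 ⟨hl.subset a ha, hl.subset b hb⟩)).2 hab⟩

/-- **Window property**: configurations agreeing on the pairs inside a finite `S` have the same minimal path. [folklore] -/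
theorem minSAP_congr {ω ω' : BondConfig V} {S X Y : Set V} (hS : S.Finite) (h : ∀ e ∈ S.sym2, e ∈ ω ↔ e ∈ ω') :
    minSAP ω S X Y = minSAP ω' S X Y := by
  by_cases hex : ∃ l, OpenSAP ω S X Y l
  · obtain ⟨h1, h2⟩ := minSAP_spec hS hex
    symm
    exact minSAP_eq_of_min hS ((openSAP_congr h _).1 h1) fun l' hl' => h2 l' ((openSAP_congr h _).2 hl')
  · rw [minSAP_eq_nil hex, minSAP_eq_nil]
    rintro ⟨l, hl⟩
    exact hex ⟨l, (openSAP_congr h _).2 hl⟩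

end Paths

end Summit.CriticalPhenomena.PercolationContinuityZ3.Theorems.Transplant

end
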